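import Summits.NavierStokesRegularity.NavierStokesRegularity.Theorems.PlaneEnergyCeilingPlanarEnergyLiouvilleOfNoLocalTypeI
import Literature.Analysis.FluidPDE.AncientL3BackwardLiouvilleHolds
import HarnessLib

/-!
# Route PlaneEnergyCeiling · crux `PlanarEnergyLiouville` (stmt-NavierStokesRegularity-16856):
# the `L³` / finite-energy corner, UNCONDITIONALLY

Theorems file for the crux item stmt-NavierStokesRegularity-16856
(`Theses.PlaneEnergyCeiling.PlanarEnergyLiouville`). The route thesis names two elementary
corners of the crux ("finite-energy corner elementary"; the grounder's "`L³` corner",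
`AncientL3BackwardLiouville.lean`). With the transfer of the crux class to the Oseen-mild class
(`oseenMild_and_morrey_of_planar`) both follow from the tree's PROVED rendering of
Albritton–Barker 2019, Thm 1.2 (`AlbrittonBarker2019_liouville_L3_backward_holds`): a bounded
Oseen-mild ancient solution with `sup_k ‖v(·, t_k)‖_{L³} < ∞` along `t_k → −∞` vanishes.

* `eq_zero_of_planar_of_eLpNorm_three_seq` — in the crux class (bounded ancient mild in duality
  form, measurable slices, jointly smooth, bounded planar energies), an `L³` bound along one
  sequence of times `t_k → −∞` forces `v ≡ 0`;
* `lintegral_enorm_pow_three_le`, `eLpNorm_three_le_of_energy` — for a field bounded by `K` with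
  energy `∫ ‖w‖² ≤ E`: `‖w‖₃ ≤ (K E)^{1/3}`;
* `eq_zero_of_planar_of_energy_seq` — hence a kinetic-energy bound along one sequence of times
  `t_k → −∞` forces `v ≡ 0` (the finite-energy corner).

What remains of the crux is therefore exactly the infinite-energy, `L³`-infinite regime (e.g. sparse
unit bumps along the moment curve, which have bounded planar energies).

## References

* D. Albritton, T. Barker, J. Math. Fluid Mech. 21 (2019) = arXiv:1811.00502, Thm 1.2 and §4.
  [AlbrittonBarker2019]
* G. Koch, N. Nadirashvili, G. Seregin, V. Šverák, Acta Math. 203 (2009) = arXiv:0709.3599, §1,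
  §4 (i). [KochNadirashviliSereginSverak2009]
-/

-- Sub = summit for this single-conjunct summit: the duplicate namespace component is deliberate.
set_option linter.dupNamespace false

noncomputable section

open MeasureTheory Set Filter Metric Function Real
open _root_.Topology
open scoped ENNReal NNReal
open Literature.Analysis Literature.Analysis.FluidPDE

namespace Summit.NavierStokesRegularity.NavierStokesRegularity.Theorems.PlaneEnergyCeilingPlanarEnergyLiouville

/-- **The `L³` corner of `PlanarEnergyLiouville`, unconditionally.** In the crux class — a bounded
ancient mild solution (`ν = 1`, duality form) with measurable slices, jointly smooth on
`(−∞,0) × ℝ³`, planar energies bounded on every plane and slice — an `L³` bound along one sequence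
of times `t_k → −∞` forces `v ≡ 0`: the class is Oseen-mild (`oseenMild_and_morrey_of_planar`) and
Albritton–Barker's Theorem 1.2 applies (`AlbrittonBarker2019_liouville_L3_backward_holds`).
[cite: AlbrittonBarker2019, Thm 1.2] -/
theorem eq_zero_of_planar_of_eLpNorm_three_seq
    {v : ℝ → EuclideanSpace ℝ (Fin 3) → EuclideanSpace ℝ (Fin 3)}
    (hv : IsBoundedAncientMildSolution 1 v)
    (hmeas : ∀ t < 0, AEStronglyMeasurable (v t) volume)
    (hsm : ContDiffOn ℝ (⊤ : ℕ∞) (uncurry v) (Iio 0 ×ˢ univ))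
    (hpl : ∃ M : ℝ, ∀ t < 0, ∀ (R : EuclideanSpace ℝ (Fin 3) ≃ₗᵢ[ℝ] EuclideanSpace ℝ (Fin 3)) (c : ℝ),
      ∫⁻ y : EuclideanSpace ℝ (Fin 2), ‖v t (R (WithLp.toLp 2 ![y 0, y 1, c]))‖ₑ ^ 2 ≤ ENNReal.ofReal M)
    (hL3 : ∃ (τ : ℕ → ℝ) (N : ℝ≥0∞), N < ∞ ∧ Tendsto τ atTop atBot ∧ (∀ k, τ k < 0) ∧
      ∀ k, eLpNorm (v (τ k)) 3 volume ≤ N) :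
    ∀ t < 0, ∀ x, v t x = 0 := by
  obtain ⟨hoseen, -⟩ := oseenMild_and_morrey_of_planar hv hmeas hsm hpl
  exact AlbrittonBarker2019_liouville_L3_backward_holds hsm.continuousOn hv.2
    (fun t ht => hv.1.1 t ht) hoseen hL3

/-- `∫ ‖w‖ₑ³ ≤ K ∫ ‖w‖ₑ²` for a field bounded by `K`. [folklore] -/
theorem lintegral_enorm_pow_three_le {w : EuclideanSpace ℝ (Fin 3) → EuclideanSpace ℝ (Fin 3)} {K : ℝ}
    (hw : ∀ x, ‖w x‖ ≤ K) :
    ∫⁻ x, ‖w x‖ₑ ^ (3 : ℝ) ≤ ENNReal.ofReal K * ∫⁻ x, ‖w x‖ₑ ^ 2 := by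
  rw [← lintegral_const_mul' _ _ ENNReal.ofReal_ne_top]
  refine lintegral_mono fun x => ?_
  have h3 : ‖w x‖ₑ ^ (3 : ℝ) = ‖w x‖ₑ * ‖w x‖ₑ ^ 2 := by
    rw [show (3 : ℝ) = ((3 : ℕ) : ℝ) by norm_num, ENNReal.rpow_natCast, pow_succ', ]
  rw [h3]
  gcongr
  rw [← ofReal_norm]
  exact ENNReal.ofReal_le_ofReal (hw x)

/-- **`‖w‖₃ ≤ (K E)^{1/3}` for a field bounded by `K` with energy `∫ ‖w‖² ≤ E`** (`L²–L^∞`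
interpolation). [folklore] -/
theorem eLpNorm_three_le_of_energy {w : EuclideanSpace ℝ (Fin 3) → EuclideanSpace ℝ (Fin 3)} {K : ℝ}
    (hw : ∀ x, ‖w x‖ ≤ K) {E : ℝ≥0∞} (hE : ∫⁻ x, ‖w x‖ₑ ^ 2 ≤ E) :
    eLpNorm w 3 volume ≤ (ENNReal.ofReal K * E) ^ (1 / 3 : ℝ) := by
  rw [eLpNorm_eq_lintegral_rpow_enorm_toReal (by norm_num) (by norm_num)]
  have h3 : (3 : ℝ≥0∞).toReal = 3 := by norm_num
  rw [h3]
  gcongr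
  exact (lintegral_enorm_pow_three_le hw).trans (by gcongr)

/-- **The finite-energy corner of `PlanarEnergyLiouville`, unconditionally.** In the crux class, a
kinetic-energy bound `∫ ‖v(t_k)‖² ≤ E < ∞` along one sequence of times `t_k → −∞` forces `v ≡ 0`
(bounded + energy ⇒ `L³` along the sequence, `eLpNorm_three_le_of_energy`, and the `L³` corner).
[cite: AlbrittonBarker2019, Thm 1.2] -/
theorem eq_zero_of_planar_of_energy_seq
    {v : ℝ → EuclideanSpace ℝ (Fin 3) → EuclideanSpace ℝ (Fin 3)}
    (hv : IsBoundedAncientMildSolution 1 v)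
    (hmeas : ∀ t < 0, AEStronglyMeasurable (v t) volume)
    (hsm : ContDiffOn ℝ (⊤ : ℕ∞) (uncurry v) (Iio 0 ×ˢ univ))
    (hpl : ∃ M : ℝ, ∀ t < 0, ∀ (R : EuclideanSpace ℝ (Fin 3) ≃ₗᵢ[ℝ] EuclideanSpace ℝ (Fin 3)) (c : ℝ),
      ∫⁻ y : EuclideanSpace ℝ (Fin 2), ‖v t (R (WithLp.toLp 2 ![y 0, y 1, c]))‖ₑ ^ 2 ≤ ENNReal.ofReal M)
    (hE : ∃ (τ : ℕ → ℝ) (E : ℝ≥0∞), E < ∞ ∧ Tendsto τ atTop atBot ∧ (∀ k, τ k < 0) ∧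
      ∀ k, ∫⁻ x, ‖v (τ k) x‖ₑ ^ 2 ≤ E) :
    ∀ t < 0, ∀ x, v t x = 0 := by
  obtain ⟨τ, E, hEt, hτ, hτ0, hEk⟩ := hE
  obtain ⟨K, hK⟩ := hv.2
  refine eq_zero_of_planar_of_eLpNorm_three_seq hv hmeas hsm hpl
    ⟨τ, (ENNReal.ofReal K * E) ^ (1 / 3 : ℝ), ?_, hτ, hτ0, fun k => ?_⟩
  · exact ENNReal.rpow_lt_top_of_nonneg (by norm_num)
      (ENNReal.mul_ne_top ENNReal.ofReal_ne_top hEt.ne)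
  · exact eLpNorm_three_le_of_energy (hK _ (hτ0 k)) (hEk k)


/-- **Registered sub-goal `planarEnergyLiouville_energyCorner` of the crux item
stmt-NavierStokesRegularity-16856** (the finite-energy corner of `PlanarEnergyLiouville`, fully
qualified, explicit binders): the crux under the extra hypothesis of a kinetic-energy bound along one
sequence of times `t_k → −∞`. [cite: AlbrittonBarker2019, Thm 1.2] -/
theorem planarEnergyLiouville_energyCorner :
    ∀ (v : ℝ → EuclideanSpace ℝ (Fin 3) → EuclideanSpace ℝ (Fin 3)),
      Literature.Analysis.FluidPDE.IsBoundedAncientMildSolution 1 v →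
      (∀ t < 0, MeasureTheory.AEStronglyMeasurable (v t) MeasureTheory.volume) →
      ContDiffOn ℝ (⊤ : ℕ∞) (Function.uncurry v) (Set.Iio 0 ×ˢ Set.univ) →
      (∃ M : ℝ, ∀ t < 0, ∀ (R : EuclideanSpace ℝ (Fin 3) ≃ₗᵢ[ℝ] EuclideanSpace ℝ (Fin 3)) (c : ℝ),
        ∫⁻ y : EuclideanSpace ℝ (Fin 2), ‖v t (R (WithLp.toLp 2 ![y 0, y 1, c]))‖ₑ ^ 2 ≤ ENNReal.ofReal M) →
      (∃ (τ : ℕ → ℝ) (E : ENNReal), E < ⊤ ∧ Filter.Tendsto τ Filter.atTop Filter.atBot ∧ (∀ k, τ k < 0) ∧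
        ∀ k, ∫⁻ x, ‖v (τ k) x‖ₑ ^ 2 ≤ E) →
      ∀ t < 0, ∀ x, v t x = 0 :=
  fun _ hv hmeas hsm hpl hE => eq_zero_of_planar_of_energy_seq hv hmeas hsm hpl hE

end Summit.NavierStokesRegularity.NavierStokesRegularity.Theorems.PlaneEnergyCeilingPlanarEnergyLiouville

end
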